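import Literature.Probability.Percolation.ProdBernoulliRusso
import Literature.Probability.Percolation.SharpnessDCTProofs
import HarnessLib

/-!
# Stub `stub_pivotalPos` of crux `ModelFacts` (stmt-CriticalPhenomena-16064), line `pushforward`

Crux: `Summit.CriticalPhenomena.PercolationContinuityZ3.Theses.PercExchangeRateTransport.ModelFacts`
(bookkeeping for the label-coupled anisotropic bond-percolation family on `ℤ²×ℤ`), registered
skeleton `Cruxes/ModelFacts/Lines/pushforward.lean`. This file proves the registered stub
VERBATIM:

`stub_pivotalPos : ∀ q, (∀ e ∈ E(ℤ³), 0 < q e) → (∀ e, q e < 1) → ∀ n ≥ 1,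
  0 < (prodBernoulli q).real {ω | IsPivotal (siteToBoundary 3 n) s(0, e_x) ω}`

— for ANY parameter field `q` positive on the lattice edges and `< 1` everywhere, the first bond
`e₀ = s(0, e_x)` of the straight `x`-path is pivotal for `{0 ⟷ ∂Λ_n in Λ_n}` with positive
probability (the term of `e₀` in the two-parameter Russo sum bounds `∂_p Θ_n` below, clause (8)
of the crux). The guard `1 ≤ n` is load-bearing (`siteToBoundary 3 0 = univ`).

Argument (Grimmett 1999, §2.4, proof of Thm. 2.25 / finite energy): let `K = (Λ_n).sym2` (the
pairs determining the event) and `T = {s(k e_x, (k+1) e_x) | 1 ≤ k < n}` (the straight path minus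
`e₀`). On the cylinder `[T]_K = {ω | ∀ e ∈ K, e ∈ ω ↔ e ∈ T}`:
* `e₀ ∈ K ∖ T`, so `e₀` is closed;
* `insert e₀ ω ∈ {0 ⟷ ∂Λ_n}`: the straight path `0, e_x, …, n e_x` is open, lies in `Λ_n`, and
  `n e_x ∈ ∂Λ_n` (`insert_mem_siteToBoundary`);
* `ω ∉ {0 ⟷ ∂Λ_n}`: an open path in `Λ_n` from `0` to `∂Λ_n ∌ 0` (`n ≥ 1`) starts with an open
  bond `s(0, u)`, `u ∈ Λ_n`, which lies in `K`, hence in `T` — but no bond of `T` contains the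
  origin (`notMem_siteToBoundary`);
so `[T]_K ⊆ {e₀ pivotal}` (`Russo.isPivotal_iff_of_notMem`), and
`P_q([T]_K) = ∏_{e ∈ K ∩ T} q_e ∏_{e ∈ K ∖ T} (1 - q_e) > 0` (`prodBernoulli_real_localCylinder`),
the bonds of `T` being lattice edges.

Tree lemmas used: `DCT16.mem_siteToBoundary_iff`, `DCT16.pathIn_induction`,
`DCT16.mem_innerBoundary_box_of_natAbs_eq`, `DCT16.notMem_box_of_mem_innerBoundary_box`,
`isUpperSet_siteToBoundary`, `Russo.isPivotal_iff_of_notMem`, `prodBernoulli_real_localCylinder`,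
`zdGraph_adj_iff`, `mem_box`, `zero_mem_box`, `openGraph_adj`.
-/

noncomputable section

open MeasureTheory
open Literature.Probability.Percolation Literature.Probability.LatticeModels
open Literature.Probability.Percolation.DCT16

namespace Summit.CriticalPhenomena.PercolationContinuityZ3.Theorems.ModelFacts

namespace PivotalPos

/-! ## Geometry of the straight `x`-path `k ↦ k e_x = Pi.single 0 k` in `ℤ³` -/

/-- The sites `k e_x`, `k ≤ n`, lie in `Λ_n`. [folklore] -/
theorem single_mem_box {n k : ℕ} (hk : k ≤ n) :
    (Pi.single (0 : Fin 3) (k : ℤ) : Site 3) ∈ box 3 n := by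
  rw [mem_box]
  intro i
  by_cases hi : i = 0
  · subst hi
    simp only [Pi.single_eq_same]
    omega
  · simp only [Pi.single_apply, if_neg hi]
    omega

/-- `n e_x ∈ ∂Λ_n`. [folklore] -/
theorem single_mem_innerBoundary (n : ℕ) :
    (Pi.single (0 : Fin 3) (n : ℤ) : Site 3) ∈ innerBoundary (zdGraph 3) (box 3 n) :=
  mem_innerBoundary_box_of_natAbs_eq (single_mem_box le_rfl) (i := 0) (by simp)

/-- Consecutive sites `k e_x ∼ (k+1) e_x` of the straight path are neighbours in `ℤ³`.
[folklore] -/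
theorem single_adj_single_succ (k : ℕ) :
    (zdGraph 3).Adj (Pi.single (0 : Fin 3) (k : ℤ) : Site 3)
      (Pi.single (0 : Fin 3) ((k + 1 : ℕ) : ℤ)) :=
  (zdGraph_adj_iff _ _).2
    ⟨0, Or.inl (by push_cast; exact Pi.single_add (f := fun _ : Fin 3 => ℤ) 0 (k : ℤ) 1)⟩

/-- The bonds `s(k e_x, (k+1) e_x)` of the straight path are lattice edges. [folklore] -/
theorem bond_mem_edgeSet (k : ℕ) :
    s((Pi.single (0 : Fin 3) (k : ℤ) : Site 3), Pi.single (0 : Fin 3) ((k + 1 : ℕ) : ℤ)) ∈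
      (zdGraph 3).edgeSet :=
  (SimpleGraph.mem_edgeSet _).2 (single_adj_single_succ k)

/-- The bonds `s(k e_x, (k+1) e_x)`, `k ≥ 1`, of the straight path avoid the origin (their sites
have first coordinate `≥ 1`). [folklore] -/
theorem zero_notMem_bond {k : ℕ} (hk : 1 ≤ k) :
    (0 : Site 3) ∉
      s((Pi.single (0 : Fin 3) (k : ℤ) : Site 3), Pi.single (0 : Fin 3) ((k + 1 : ℕ) : ℤ)) := by
  rw [Sym2.mem_iff]
  rintro (h | h) <;> have h0 := congr_fun h 0 <;>
    simp only [Pi.single_eq_same, Pi.zero_apply] at h0 <;> omega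

/-- `e₀ = s(0, e_x)` is a pair of sites of `Λ_n` for `n ≥ 1`. [folklore] -/
theorem e0_mem_sym2_box {n : ℕ} (hn : 1 ≤ n) :
    s((0 : Site 3), Pi.single (0 : Fin 3) 1) ∈ (box 3 n).sym2 := by
  rw [Finset.mk_mem_sym2_iff]
  refine ⟨zero_mem_box 3 n, ?_⟩
  have h := single_mem_box (n := n) (k := 1) hn
  rwa [Nat.cast_one] at h

/-- `e₀ = s(0, e_x)` is not one of the bonds `s(k e_x, (k+1) e_x)`, `1 ≤ k < n`. [folklore] -/
theorem e0_notMem (n : ℕ) :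
    s((0 : Site 3), Pi.single (0 : Fin 3) 1) ∉ {e : Sym2 (Site 3) | ∃ k : ℕ, 1 ≤ k ∧ k < n ∧
      e = s((Pi.single (0 : Fin 3) (k : ℤ) : Site 3),
        Pi.single (0 : Fin 3) ((k + 1 : ℕ) : ℤ))} := by
  rintro ⟨k, hk1, -, hk⟩
  exact zero_notMem_bond hk1 (by rw [← hk]; exact Sym2.mem_mk_left _ _)

/-! ## The cylinder `[T]_K` lies in `{e₀ pivotal}` -/

/-- **Opening `e₀` connects `0` to `∂Λ_n`.** On the cylinder `[T]_K` (bonds of the straight path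
beyond `e_x` open), `insert e₀ ω ∈ {0 ⟷ ∂Λ_n in Λ_n}`: the path `0, e_x, 2e_x, …, n e_x` is open
and `n e_x ∈ ∂Λ_n`. [folklore] -/
theorem insert_mem_siteToBoundary {n : ℕ} {ω : Set (Sym2 (Site 3))}
    (hω : ω ∈ localCylinder (↑((box 3 n).sym2) : Set (Sym2 (Site 3)))
      {e | ∃ k : ℕ, 1 ≤ k ∧ k < n ∧
        e = s((Pi.single (0 : Fin 3) (k : ℤ) : Site 3), Pi.single (0 : Fin 3) ((k + 1 : ℕ) : ℤ))}) :
    insert s((0 : Site 3), Pi.single (0 : Fin 3) 1) ω ∈ siteToBoundary 3 n := by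
  rw [mem_siteToBoundary_iff]
  refine ⟨Pi.single 0 (n : ℤ), single_mem_innerBoundary n, ?_⟩
  suffices h : ∀ k, k ≤ n →
      PathIn (openGraph (insert s((0 : Site 3), Pi.single (0 : Fin 3) 1) ω)) ↑(box 3 n) 0
        (Pi.single (0 : Fin 3) (k : ℤ)) from h n le_rfl
  intro k
  induction k with
  | zero =>
    intro _
    simp only [Nat.cast_zero, Pi.single_zero]
    exact PathIn.refl (zero_mem_box 3 n)
  | succ k ih =>
    intro hk
    refine (ih (Nat.le_of_succ_le hk)).tail ?_ (single_mem_box hk)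
    rw [openGraph_adj]
    refine ⟨?_, (single_adj_single_succ k).ne⟩
    rcases Nat.eq_zero_or_pos k with rfl | hk0
    · simp
    · refine Set.mem_insert_of_mem _ ((hω _ ?_).2 ⟨k, hk0, Nat.lt_of_succ_le hk, rfl⟩)
      exact Finset.mk_mem_sym2_iff.2 ⟨single_mem_box (Nat.le_of_succ_le hk), single_mem_box hk⟩

/-- **Without `e₀` the origin is cut off.** On the cylinder `[T]_K`, `ω ∉ {0 ⟷ ∂Λ_n in Λ_n}` for
`n ≥ 1`: an open path inside `Λ_n` from `0` to `∂Λ_n ∌ 0` starts with an open bond `s(0, u)`,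
`u ∈ Λ_n`, a pair of `K`, hence a bond of `T`; but no bond of `T` contains `0`. [folklore] -/
theorem notMem_siteToBoundary {n : ℕ} (hn : 1 ≤ n) {ω : Set (Sym2 (Site 3))}
    (hω : ω ∈ localCylinder (↑((box 3 n).sym2) : Set (Sym2 (Site 3)))
      {e | ∃ k : ℕ, 1 ≤ k ∧ k < n ∧
        e = s((Pi.single (0 : Fin 3) (k : ℤ) : Site 3), Pi.single (0 : Fin 3) ((k + 1 : ℕ) : ℤ))}) :
    ω ∉ siteToBoundary 3 n := by
  rw [mem_siteToBoundary_iff]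
  rintro ⟨y, hy, hpath⟩
  have hy0 : y ≠ 0 := by
    rintro rfl
    exact notMem_box_of_mem_innerBoundary_box (Nat.lt_of_succ_le hn) hy (zero_mem_box 3 0)
  refine hy0 (pathIn_induction (fun z => z = (0 : Site 3)) hpath rfl ?_)
  rintro a b - hb rfl hab
  exfalso
  have h1 : s((0 : Site 3), b) ∈ ω := ((openGraph_adj ω 0 b).1 hab).1
  have h2 : s((0 : Site 3), b) ∈ (↑((box 3 n).sym2) : Set (Sym2 (Site 3))) :=
    Finset.mk_mem_sym2_iff.2 ⟨zero_mem_box 3 n, hb⟩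
  obtain ⟨k, hk1, -, hk⟩ := (hω _ h2).1 h1
  exact zero_notMem_bond hk1 (by rw [← hk]; exact Sym2.mem_mk_left _ _)

/-- **The cylinder `[T]_K` lies in `{e₀ pivotal for {0 ⟷ ∂Λ_n}}`** (`n ≥ 1`): `e₀ ∈ K ∖ T` is
closed on the cylinder, opening it creates the connection and without it there is none
(`Russo.isPivotal_iff_of_notMem`). [folklore] -/
theorem localCylinder_subset_pivotal {n : ℕ} (hn : 1 ≤ n) :
    localCylinder (↑((box 3 n).sym2) : Set (Sym2 (Site 3)))
        {e | ∃ k : ℕ, 1 ≤ k ∧ k < n ∧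
          e = s((Pi.single (0 : Fin 3) (k : ℤ) : Site 3),
            Pi.single (0 : Fin 3) ((k + 1 : ℕ) : ℤ))} ⊆
      {ω | IsPivotal (siteToBoundary 3 n) s((0 : Site 3), Pi.single (0 : Fin 3) 1) ω} := by
  intro ω hω
  have he₀ : s((0 : Site 3), Pi.single (0 : Fin 3) 1) ∉ ω :=
    fun h => e0_notMem n ((hω _ (Finset.mem_coe.2 (e0_mem_sym2_box hn))).1 h)
  rw [Set.mem_setOf_eq, Russo.isPivotal_iff_of_notMem (isUpperSet_siteToBoundary 3 n) he₀]
  exact ⟨insert_mem_siteToBoundary hω, notMem_siteToBoundary hn hω⟩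

/-- **The cylinder `[T]_K` has positive probability**: `P_q([T]_K) = ∏_{e ∈ K} w_e` with
`w_e = q_e > 0` for the lattice edges `e ∈ T` and `w_e = 1 - q_e > 0` otherwise. [folklore] -/
theorem real_localCylinder_pos (q : Sym2 (Site 3) → unitInterval)
    (hq0 : ∀ e ∈ (zdGraph 3).edgeSet, 0 < (q e : ℝ)) (hq1 : ∀ e, (q e : ℝ) < 1) (n : ℕ) :
    0 < (prodBernoulli q).real (localCylinder (↑((box 3 n).sym2) : Set (Sym2 (Site 3)))
        {e | ∃ k : ℕ, 1 ≤ k ∧ k < n ∧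
          e = s((Pi.single (0 : Fin 3) (k : ℤ) : Site 3),
            Pi.single (0 : Fin 3) ((k + 1 : ℕ) : ℤ))}) := by
  rw [Literature.Probability.Percolation.prodBernoulli_real_localCylinder]
  refine Finset.prod_pos fun e _ => ?_
  split_ifs with he
  · obtain ⟨k, -, -, rfl⟩ := he
    exact hq0 _ (bond_mem_edgeSet k)
  · exact sub_pos.2 (hq1 e)

end PivotalPos

/-- **Stub 3 (registered) of the line `pushforward`: the first bond of the straight `x`-path is
pivotal with positive probability.** For any parameter field `q` positive on `E(ℤ³)` and `< 1`
everywhere, and any `n ≥ 1`, `0 < (prodBernoulli q)(s(0, e_x) pivotal for {0 ⟷ ∂Λ_n})`: the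
cylinder "straight path beyond `e_x` open, every other pair of `Λ_n` closed" lies in the pivotal
event and has positive probability. (Grimmett 1999, §2.4.) [folklore] -/
theorem stub_pivotalPos :
    ∀ (q : Sym2 (Site 3) → unitInterval),
    (∀ e ∈ (zdGraph 3).edgeSet, 0 < (q e : ℝ)) → (∀ e, (q e : ℝ) < 1) →
    ∀ n : ℕ, 1 ≤ n →
      0 < (prodBernoulli q).real
        {ω | IsPivotal (siteToBoundary 3 n) s((0 : Site 3), Pi.single (0 : Fin 3) 1) ω} := by
  intro q hq0 hq1 n hn
  exact (PivotalPos.real_localCylinder_pos q hq0 hq1 n).trans_le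
    (measureReal_mono (PivotalPos.localCylinder_subset_pivotal hn))

end Summit.CriticalPhenomena.PercolationContinuityZ3.Theorems.ModelFacts

end
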